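import Summits.QuantumFields.BalabanUV.T4Continuum.Support.InsertionLinearClass
import Summits.QuantumFields.BalabanUV.T4Continuum.Support.ActivityStepJunction
import Summits.QuantumFields.BalabanUV.T4Continuum.Support.StepRecursion

/-!
# NE5 ∕ U3, route P2 — W4 WITHOUT ANALYTICITY for the linear insertion class: `InsertionRate` from the two-spacing rates of the
# insertion DATA (base parts and insertion vectors), and the route's END with W3 ∧ W4 both read from the linear class
# (skeleton `t4/skeletons/NE5-t4-ne5-p2.md` §6 row A3b)

Cell `pub-balaban`, unit `b2b-balaban-t4-ne5-p2-g17` (T⁴ fan-out NE5 ∕ node U3, PROVER seat P2 «polymer-activity Lipschitz route»).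
Summits-side new work under the LEAN PLACEMENT RULE (cell bookkeeping; NOT a Literature module).  HONEST FRAMING: rung (B)+1 of the
FINITE-VOLUME T⁴ continuum programme — NOT infinite volume, NOT a mass gap, NOT the Clay problem, NOT a proof of NE5 (NOT PRINTED in
[Balaban1987RG1]–[Balaban1989LargeFieldII]; they print ε-UNIFORM bounds, never η-RATES).  HONEST DEPENDENCY (cell line, verbatim):
continuum YM on T⁴ ⇐ BetaPertH ∧ nine spine estimates (0/9 proved); BetaPertH ⇐ (D1) ∧ (D4) ∧ CAP+tail; G-an2-4 gates asym, D1 and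
NE2/3/4.

WHAT THIS FILE DOES.  The row owner PRODUCES W4 `StepModel.InsertionRate` from W1 by a Cauchy estimate along complex operator lines of
the insertion (`OutputRateInsertion.insertionRate_of_operatorRate`; its one-run input `InsOpEnvelope` is an ANALYTICITY binder, W2-ins).
On the activity route's LINEAR insertion class (`InsertionLinearClass.LinearInsertion`: `ins g U k t = base g U k + Σ_{Y ∈ dom k}
(t Y)•vec g U k Y` — the printed STRUCTURE of [Balaban1988RG2Cluster] (1.33) p. 9 ∕ (1.41) p. 11: the earlier actions enter linearly)
NO analyticity is needed: if BOTH runs' insertions are read from linear classes over the same earlier domains (`Reads`, `ReadsB`,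
`hdom`), then
  `‖insA t − insB t‖ ≤ ‖baseA − baseB‖ + Σ_Y |t Y|·‖vecA Y − vecB Y‖`,
so W4 follows from TWO displayed two-spacing rates of the insertion DATA — `BaseRate δb θ` (the table-independent parts) and
`VecRate κ δv θ` (the `e^{−κd}`-weighted ℓ¹ rate of the insertion vectors) — with `δ′ = δb + E₀·δv` (`insertionRate_of_linear`).
These are NE2-TYPE inputs (η-rates of the fine-lattice localization ∕ re-expression operators the vectors are built from — node
U1a's objects, NOT PRINTED: B5∕B6∕B9 print η-uniform bounds only), displayed by name; nothing of an output rate is in them.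
Then `ne5_above_max_of_model_reach_linear`: the route's END (`ActivityStepJunction`; cf. `ActivityRouteEnd` for the Cauchy-produced W4) with W3 (`InsScaleBound`
⇐ `AgeBudget`, `InsertionLinearClass.insScaleBound_of_ageBudget`), the structure binders (`InsAffine`∕`InsBlind`∕`InsHomog` by
construction) AND W4 (this file) all read from the linear class: the remaining binders of two-spacing-rate type are W1
`N.OperatorRate` (nodes U1a∕U1b by name) and the insertion-data rates `BaseRate`∕`VecRate`; NO analyticity hypothesis anywhere on
the route.  0 sorry; no new axioms; the manuscripts under audit are cited for KIND∕locus only.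

v1.1 (APPEND-ONLY, same gen; XREAD C-ne5leaf09-1 INFO-2∕(d) folded): §MI-R — `insBlindB_of_readsB` (run B's blindness BY CONSTRUCTION
for the linear class, the twin of `InsertionLinearClass.insBlind_of_reads`) and `represents_rec_of_linear` (MI-R = L01 ∧ L02 BY CONSTRUCTION:
both insertions linear + run A's data read at the transported background ⟹ `RepresentsA (recA M) ∧ RepresentsB (recB M)` via `StepRecursion`).
-/

open scoped BigOperators

namespace Summit.QuantumFields.BalabanUV.T4Continuum.InsertionLinearRate

open Literature.MathematicalPhysics.QuantumFieldTheory.Balaban1983to89.T4OutputRate (Carriers Functional DecayBound NE5)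
open Literature.MathematicalPhysics.QuantumFieldTheory.Balaban1983to89.T4ActivityLipschitz (ClusterRep)
open Literature.MathematicalPhysics.QuantumFieldTheory.Balaban1983to89.T4ActivityRecursion (KPInflated)
open Literature.MathematicalPhysics.QuantumFieldTheory.Balaban1983to89.T4InputCauchyRateData (StepModel)
open Summit.QuantumFields.BalabanUV.T4Continuum.InsertionLinearClass (LinearInsertion)
open Summit.QuantumFields.BalabanUV.T4Continuum.ActivityTermModel (TermFamily)
open Summit.QuantumFields.BalabanUV.T4Continuum.ActivityStepJunction (ReadsStep)

variable {C : Carriers} {Op Hist : Type*} [NormedAddCommGroup Op] [NormedSpace ℂ Op] [NormedAddCommGroup Hist]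
  [NormedSpace ℂ Hist]

namespace LinearPair

/-- [folklore] HYPOTHESIS SHAPE (reading, run B): run B's insertion of the step model IS the class's insertion. -/
def ReadsB (LB : LinearInsertion C Hist) (M : StepModel C Op Hist) (W : Set (ℕ → ℝ)) : Prop :=
  ∀ k, ∀ g ∈ W, ∀ (U : C.BgB) (t : C.Dom → ℝ), M.insB g U k t = LB.ins g U k t

/-- [folklore] HYPOTHESIS SHAPE `BaseRate δb θ` (NE2-TYPE, NOT PRINTED; displayed): the two runs' table-independent parts of the
step-`k` inserted history differ by at most `δb·θ^k` history margins. -/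
def BaseRate (LA LB : LinearInsertion C Hist) (M : StepModel C Op Hist) (W : Set (ℕ → ℝ)) (δb θ : ℝ) : Prop :=
  ∀ k, ∀ g ∈ W, ∀ U : C.BgB, ‖LA.base g U k - LB.base g U k‖ ≤ δb * θ ^ k * M.rHist k

/-- [folklore] HYPOTHESIS SHAPE `VecRate κ δv θ` (NE2-TYPE, NOT PRINTED; displayed): the `e^{−κd}`-weighted ℓ¹ two-spacing rate of
the insertion vectors at step `k` is at most `δv·θ^k` history margins. -/
def VecRate (LA LB : LinearInsertion C Hist) (M : StepModel C Op Hist) (W : Set (ℕ → ℝ)) (κ δv θ : ℝ) : Prop :=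
  ∀ k, ∀ g ∈ W, ∀ U : C.BgB,
    ∑ Y ∈ LA.dom k, Real.exp (-(κ * C.d Y)) * ‖LA.vec g U k Y - LB.vec g U k Y‖ ≤ δv * θ ^ k * M.rHist k

variable {LA LB : LinearInsertion C Hist} {M : StepModel C Op Hist} {W : Set (ℕ → ℝ)}

/-- [folklore] The difference of the two runs' linear insertions over a common domain set. -/
theorem ins_sub_ins (hdom : ∀ k, LA.dom k = LB.dom k) (g : ℕ → ℝ) (U : C.BgB) (k : ℕ) (t : C.Dom → ℝ) :
    LA.ins g U k t - LB.ins g U k t =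
      (LA.base g U k - LB.base g U k) + ∑ Y ∈ LA.dom k, ((t Y : ℝ) : ℂ) • (LA.vec g U k Y - LB.vec g U k Y) := by
  simp only [LinearInsertion.ins, ← hdom k, smul_sub, Finset.sum_sub_distrib]
  abel

/-- [folklore] **W4 WITHOUT ANALYTICITY for the linear class**: `Reads ∧ ReadsB ∧ (common domains) ∧ BaseRate δb θ ∧ VecRate κ δv θ`
⟹ `M.InsertionRate W κ E₀ (δb + E₀·δv) θ` for every level `E₀ ≥ 0` (triangle inequality + the two displayed rates; nothing else). -/
theorem insertionRate_of_linear {κ E₀ δb δv θ : ℝ} (hA : LA.Reads M W) (hB : ReadsB LB M W) (hdom : ∀ k, LA.dom k = LB.dom k)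
    (hbase : BaseRate LA LB M W δb θ) (hvec : VecRate LA LB M W κ δv θ) (hE₀ : 0 ≤ E₀) :
    M.InsertionRate W κ E₀ (δb + E₀ * δv) θ := by
  intro k g hg U t ht
  rw [hA k g hg U t, hB k g hg U t, ins_sub_ins hdom]
  have hsum : ‖∑ Y ∈ LA.dom k, ((t Y : ℝ) : ℂ) • (LA.vec g U k Y - LB.vec g U k Y)‖ ≤
      E₀ * ∑ Y ∈ LA.dom k, Real.exp (-(κ * C.d Y)) * ‖LA.vec g U k Y - LB.vec g U k Y‖ := by
    rw [Finset.mul_sum]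
    refine (norm_sum_le _ _).trans (Finset.sum_le_sum fun Y _ => ?_)
    rw [norm_smul, Complex.norm_real, Real.norm_eq_abs]
    calc |t Y| * ‖LA.vec g U k Y - LB.vec g U k Y‖
        ≤ E₀ * Real.exp (-(κ * C.d Y)) * ‖LA.vec g U k Y - LB.vec g U k Y‖ :=
          mul_le_mul_of_nonneg_right (ht Y) (norm_nonneg _)
      _ = E₀ * (Real.exp (-(κ * C.d Y)) * ‖LA.vec g U k Y - LB.vec g U k Y‖) := by ring
  calc ‖(LA.base g U k - LB.base g U k) + ∑ Y ∈ LA.dom k, ((t Y : ℝ) : ℂ) • (LA.vec g U k Y - LB.vec g U k Y)‖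
      ≤ ‖LA.base g U k - LB.base g U k‖ + ‖∑ Y ∈ LA.dom k, ((t Y : ℝ) : ℂ) • (LA.vec g U k Y - LB.vec g U k Y)‖ :=
        norm_add_le _ _
    _ ≤ δb * θ ^ k * M.rHist k + E₀ * (δv * θ ^ k * M.rHist k) :=
        add_le_add (hbase k g hg U) (hsum.trans (mul_le_mul_of_nonneg_left (hvec k g hg U) hE₀))
    _ = (δb + E₀ * δv) * θ ^ k * M.rHist k := by ring

end LinearPair

/-! ## The route's END with W3 ∧ W4 read from the linear insertion class (no analyticity anywhere) -/

section End

open LinearPair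

variable {R : ClusterRep C}
variable {ι κ S Ω Ω₀ 𝒴 𝒞 : Type*} [Fintype ι] [Fintype κ] [MeasurableSpace Ω] [MeasurableSpace Ω₀] {J : Type*}
  [DecidableEq ι] [DecidableEq κ] [DecidableEq 𝒞] (𝔉 : TermFamily R Op Hist ι κ S Ω Ω₀ 𝒴 𝒞 J)

/-- [folklore] **END-T WITH THE INSERTION BINDERS READ FROM THE LINEAR CLASS.**  For a term model reading the step model `N`, with
BOTH runs' insertions linear over common earlier domains: W3 `InsScaleBound` ⇐ `AgeBudget` (one run), the structure binders by
construction, W4 ⇐ `BaseRate` ∧ `VecRate` (this file); the binders of two-spacing-rate type left are W1 `N.OperatorRate W δ θ` and the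
insertion-data rates `δb`, `δv` — all NE2-TYPE, displayed; NO analyticity hypothesis.  Conclusion LITERALLY `∃ C₅, NE5 EA EB W κ θ′ C₅`. -/
theorem ne5_above_max_of_model_reach_linear {N : StepModel C Op Hist} (hN : ReadsStep 𝔉.model N)
    {EA : Functional C C.BgA} {EB : Functional C C.BgB} {W : Set (ℕ → ℝ)}
    {LA LB : LinearInsertion C Hist} (hLA : LA.Reads N W) (hLB : ReadsB LB N W) (hdom : ∀ k, LA.dom k = LB.dom k)
    {m : (ℕ → ℝ) → C.BgB → R.P → ℝ} {a d : R.P → ℝ} {δX : C.Dom → ℝ}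
    {A A₀ E₀ E₁ κ θ δ δb δv c ω s Λop Λhist ρ₀ ρ₀' : ℝ}
    (hwf : 𝔉.WellFormed W)
    (hsum : ∀ g ∈ W, ∀ (U : C.BgB) (X : C.Dom), ∀ γ ∈ R.vol X, ∑ i ∈ 𝔉.terms g U X γ, 𝔉.G Λop Λhist ρ₀ g U X γ i ≤ m g U γ)
    (hρ01 : ρ₀ ≤ 1)
    (hrep : R.Represents EA EB) (hreal : 𝔉.model.Realizes EA EB W) (hbase : 𝔉.model.InBase EB W)
    (hKP : KPInflated R W m s a d) (hdec : R.DecayExtract δX d) (hpin : R.PinBudget a δX A κ)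
    (hdA : DecayBound EA W A₀ κ) (hdB : DecayBound EB W E₀ κ)
    (hop : N.OperatorRate W δ θ)
    (hbr : BaseRate LA LB N W δb θ) (hvr : VecRate LA LB N W κ δv θ) (hbudget : LA.AgeBudget N W κ c ω)
    (hE₀ : 0 ≤ E₀) (hδb : 0 ≤ δb) (hδv : 0 ≤ δv)
    (hE₁ : 0 < E₁) (hA : 0 ≤ A) (hΛop : 0 < Λop) (hΛhist : 0 < Λhist) (hρ : max (Λhist / Λop) 1 * ρ₀' ≤ ρ₀)
    (hs : Λhist * ρ₀' < s) (hδ : 0 ≤ δ) (hθ : 0 ≤ θ) (hθ1 : θ < 1)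
    (hc : 0 ≤ c) (hω : 0 < ω) (hω1 : ω < 1) (hreach : c * (A₀ + E₀) / (1 - ω) < ρ₀')
    {θ' : ℝ} (hθ' : max θ (ω + A * Λhist / (s - Λhist * ρ₀') * c) < θ') :
    ∃ C₅, NE5 EA EB W κ θ' C₅ :=
  ActivityStepJunction.TermFamily.ne5_above_max_of_model_reach_step 𝔉 hN hwf hsum hρ01 hrep hreal hbase hKP hdec hpin hdA hdB
    hop (insertionRate_of_linear hLA hLB hdom hbr hvr hE₀) (LinearInsertion.insAffine_of_reads hLA)
    (LinearInsertion.insBlind_of_reads hLA) (LinearInsertion.insHomog_of_reads hLA)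
    (LinearInsertion.insScaleBound_of_ageBudget hLA hbudget hE₁.le) hE₁ hA hΛop hΛhist hρ hs hδ
    (add_nonneg hδb (mul_nonneg hE₀ hδv)) hθ hθ1 hc hω hω1 hreach hθ'

end End

/-! ## MI-R for the linear class (v1.1, APPEND-ONLY): blindness of BOTH runs by construction ⟹ `Represents*` for the recursive outputs -/

section MIR

open Summit.QuantumFields.BalabanUV.T4Continuum.StepRecursion (InsBlindB ReadsTransported recA recB representsA_recA representsB_recB)
open LinearPair

variable {LA LB : LinearInsertion C Hist} {M : StepModel C Op Hist} {W : Set (ℕ → ℝ)}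

/-- [folklore] **Run B's `InsBlindB` BY CONSTRUCTION** for the linear class (the twin of `InsertionLinearClass.insBlind_of_reads`). -/
theorem insBlindB_of_readsB (h : ReadsB LB M W) : InsBlindB M W := by
  intro k g hg U t t' htt'
  rw [h k g hg U t, h k g hg U t', ← sub_eq_zero, LB.ins_sub_ins]
  refine Finset.sum_eq_zero fun Y hY => ?_
  rw [htt' Y (LB.dom_lt k Y hY), sub_self, Complex.ofReal_zero, zero_smul]

/-- [folklore] **MI-R (L01 ∧ L02) BY CONSTRUCTION FOR THE LINEAR CLASS**: if both runs' insertions are read from linear classes and run A's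
data are read at the transported background (`StepRecursion.ReadsTransported`), the recursively defined outputs satisfy
`RepresentsA (recA M) W ∧ RepresentsB (recB M) W` — no further hypothesis (the cross-reader's `represents_rec_of_linear`,
C-ne5leaf09-1 (d), landed). -/
theorem represents_rec_of_linear (hA : LA.Reads M W) (hB : ReadsB LB M W) (hread : ReadsTransported M W) :
    M.RepresentsA (recA M) W ∧ M.RepresentsB (recB M) W :=
  ⟨representsA_recA (LinearInsertion.insBlind_of_reads hA) hread, representsB_recB (insBlindB_of_readsB hB)⟩

end MIR

end Summit.QuantumFields.BalabanUV.T4Continuum.InsertionLinearRate
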